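import Summits.Langlands.Langlands.Theorems.RamifiedCoefficientSeedAdjointLiftingGL3BirthDefs2
import Summits.Langlands.Langlands.Theorems.RamifiedCoefficientSeedAdjointLiftingGL3StubResidualAdjointFormIrred
import Literature.NumberTheory.GaloisRepresentations.ResidualGaloisRepOpenKernel
import Literature.NumberTheory.Automorphic.LanglandsTetrahedral
import HarnessLib

/-!
# Crux `AdjointLiftingGL3` (stmt-Langlands-16779), line `birth`, stub S2c — helper 2:
# the Tate-twisted residual representation `σ̄ = ω̄^t ⊗ τ₀` over `k`

Helper file (theorems only) of stub `stub_weightTwoNewform`.  For a residual representation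
`τ₀ : Γ_ℚ → GL₂(ℤ̄_p/𝔪)` of an odd `ρ₀ : Γ_ℚ → GL₂(ℚ̄_p)`, an embedding `ιk : ℤ̄_p/𝔪 → k` into a
discrete field of characteristic `p` and an exponent `t`, we build the continuous representation
`σ̄ : Γ_ℚ → GL₂(k)`, `σ̄(γ) = ω̄(γ)^t · ιk(τ₀(γ))` (`ω̄ = omegaModP p` the mod-`p` cyclotomic
character), which is the input of Khare–Wintenberger in the stub: `exists_twistRep` (registered
sub-goal of this file).  Ingredients:

* continuity for the discrete topology of `k`: the kernel contains `ker τ₀ ∩ ker ω̄`, open by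
  `isOpen_ker_of_isResidualRepOf` and the continuity of the tree's `modPCyclotomicCharacter`
  (`isOpen_ker_omegaModP`, the tree's `MonoidHom.continuous_of_isOpen_ker`);
* oddness: `det σ̄(c) = ω̄(c)^{2t} · det τ₀(c) = -1` (`c² = 1`; `det τ₀(c)` is the reduction of
  `det ρ₀(c) = -1`, `det_eq_neg_one_of_isResidualRepOf` via `IsResidualRepOf.hasResidualCharpolys`);
* irreducibility: `ad⁰ τ₀` absolutely irreducible ⇒ `ιk ∘ τ₀` irreducible (`map_glAdZeroTwoFrame`:
  `Ad⁰` commutes with extension of scalars; the landed `isIrreducible_of_isIrreducible_adZero`) ⇒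
  the scalar twist `σ̄` is irreducible (the landed `isIrreducible_of_smul`).
-/

set_option linter.dupNamespace false -- `Summit.Langlands.Langlands` is the mandated namespace

noncomputable section

namespace Summit.Langlands.Langlands.Cruxes.AdjointLiftingGL3.Birth

open scoped MatrixGroups NumberField
open NumberField IsDedekindDomain Field Filter
open Literature.NumberTheory.GaloisRepresentations Literature.NumberTheory.PAdicHodge
open Literature.NumberTheory.Automorphic

/-! ## Generalities -/

/-- The matrix of `GL_n(f)(P)` is the entrywise image of that of `P`. [folklore] -/
theorem coe_generalLinearGroup_map {R S : Type*} [CommRing R] [CommRing S] {n : Type*} [Fintype n]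
    [DecidableEq n] (f : R →+* S) (P : GL n R) :
    ((Matrix.GeneralLinearGroup.map f P : GL n S) : Matrix n n S) = (P : Matrix n n R).map f := rfl

/-- `det M = coeff₀ (charpoly M)` for a `2 × 2` matrix. [folklore] -/
theorem det_eq_charpoly_coeff_zero_fin_two {R : Type*} [CommRing R] (M : Matrix (Fin 2) (Fin 2) R) :
    M.det = M.charpoly.coeff 0 := by
  rw [Matrix.det_eq_sign_charpoly_coeff, Fintype.card_fin]
  ring

/-- **`Ad⁰` commutes with extension of scalars**: `GL₃(f)(Ad⁰ P) = Ad⁰(GL₂(f) P)` (the entries of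
`Ad⁰ P` are polynomials in those of `P` and `P⁻¹`, `coe_glAdZeroTwoFrame_apply`). [folklore] -/
theorem map_glAdZeroTwoFrame {R S : Type*} [CommRing R] [CommRing S] (f : R →+* S) (P : GL (Fin 2) R) :
    Matrix.GeneralLinearGroup.map f (glAdZeroTwoFrame R P) =
      glAdZeroTwoFrame S (Matrix.GeneralLinearGroup.map f P) := by
  apply Units.ext
  rw [coe_generalLinearGroup_map, coe_glAdZeroTwoFrame_apply, coe_glAdZeroTwoFrame_apply, ← map_inv,
    coe_generalLinearGroup_map, coe_generalLinearGroup_map]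
  ext i j
  fin_cases i <;> fin_cases j <;> simp [adZeroTwoMatrixOf, map_sub, map_mul]

section ModP

variable {p : ℕ} [Fact p.Prime]

/-- **The kernel of the mod-`p` cyclotomic character of `Γ_ℚ` is open** (continuity of the tree's
`modPCyclotomicCharacter`, valued in the discrete `(ℤ/p)ˣ`). [folklore] -/
theorem isOpen_ker_omegaModP : IsOpen ((omegaModP p).ker : Set (absoluteGaloisGroup ℚ)) := by
  have h1 : IsOpen ((modPCyclotomicCharacter ℚ (ZMod p) p (RingHom.id (ZMod p))) ⁻¹' {1}) :=
    (isOpen_discrete _).preimage (map_continuous _)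
  convert h1 using 1
  ext γ
  simp only [SetLike.mem_coe, MonoidHom.mem_ker, Set.mem_preimage, Set.mem_singleton_iff]
  rw [Units.ext_iff, Units.ext_iff, coe_modPCyclotomicCharacter_apply, RingHom.id_apply]
  rfl

/-- **A residual representation of an odd `ρ₀` is odd**: `det τ₀(c) = -1` for every complex
conjugation `c`, since `det(X - τ₀(c))` is the reduction of `det(X - ρ₀(c))`
(`IsResidualRepOf.hasResidualCharpolys`) and `det ρ₀(c) = -1`. [folklore] -/
theorem det_eq_neg_one_of_isResidualRepOf {ρ₀ : FramedGaloisRep ℚ (PadicAlgCl p) 2} (hodd : ρ₀.IsOdd)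
    {τ₀ : absoluteGaloisGroup ℚ →* GL (Fin 2) (padicAlgClResidueField p)}
    (hτ₀ : ρ₀.IsResidualRepOf (RingHom.id _) τ₀) {φ : ℚ →+* ℝ} {c : absoluteGaloisGroup ℚ}
    (hc : IsComplexConjugation φ c) :
    ((τ₀ c : GL (Fin 2) (padicAlgClResidueField p)) :
      Matrix (Fin 2) (Fin 2) (padicAlgClResidueField p)).det = -1 := by
  obtain ⟨P, hP, hP'⟩ := hτ₀.hasResidualCharpolys c
  have hdet : ((ρ₀ c : GL (Fin 2) (PadicAlgCl p)) : Matrix (Fin 2) (Fin 2) (PadicAlgCl p)).det = -1 := by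
    have h := congrArg Units.val (hodd φ c hc)
    rwa [Matrix.GeneralLinearGroup.val_det_apply, Units.val_neg, Units.val_one] at h
  -- `P.coeff 0 = -1` in `ℤ̄_p`
  have h0 : ((P.coeff 0 : padicAlgClIntegers p) : PadicAlgCl p) = -1 := by
    have h := congrArg (fun Q : Polynomial (PadicAlgCl p) => Q.coeff 0) hP
    simp only [Polynomial.coeff_map] at h
    rw [← hdet, det_eq_charpoly_coeff_zero_fin_two]
    exact h
  have h0' : P.coeff 0 = -1 := Subtype.ext (by rw [h0]; rfl)
  -- reduce
  have h := congrArg (fun Q : Polynomial (padicAlgClResidueField p) => Q.coeff 0) hP'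
  simp only [Polynomial.coeff_map, h0', map_neg, map_one] at h
  rw [det_eq_charpoly_coeff_zero_fin_two, ← h]

end ModP

/-! ## The package -/

/-- **The Tate-twisted residual representation over `k`** (registered sub-goal of this helper
file).  For a prime `p`, a discrete field `k` of characteristic `p` with `ιk : ℤ̄_p/𝔪 → k`, an
exponent `t`, an odd `ρ₀ : Γ_ℚ → GL₂(ℚ̄_p)` and a residual representation `τ₀` of `ρ₀` with `ad⁰ τ₀`
absolutely irreducible, there is a continuous, odd, irreducible `σ̄ : Γ_ℚ → GL₂(k)` with
`σ̄(γ) = ω̄(γ)^t · ιk(τ₀(γ))` for all `γ`.  Construction: `σ̄(γ) = (ω̄(γ)^t · 1) · GL₂(ιk)(τ₀ γ)`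
(Mathlib `Matrix.GeneralLinearGroup.scalar`, `.map`; a homomorphism because scalars are central);
continuity = open kernel (`ker τ₀ ∩ ker ω̄ ⊆ ker σ̄`); oddness by `det_eq_neg_one_of_isResidualRepOf`
and `c² = 1`; irreducibility by `map_glAdZeroTwoFrame`, `isIrreducible_of_isIrreducible_adZero`
and `isIrreducible_of_smul`. [folklore] -/
theorem exists_twistRep :
    ∀ (p : ℕ) [Fact p.Prime] (k : Type) [Field k] [CharP k p] [TopologicalSpace k]
      [DiscreteTopology k] (ιk : padicAlgClResidueField p →+* k) (t : ℕ)
      (ρ₀ : FramedGaloisRep ℚ (PadicAlgCl p) 2)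
      (τ₀ : absoluteGaloisGroup ℚ →* GL (Fin 2) (padicAlgClResidueField p)),
      ρ₀.IsOdd → ρ₀.IsResidualRepOf (RingHom.id _) τ₀ → IsAbsIrreducible (adZeroOf τ₀) →
      ∃ σb : ModPGaloisRep ℚ k 2, FramedGaloisRep.IsOdd σb ∧ σb.toGaloisRep.IsIrreducible ∧
        ∀ γ, ((σb γ : GL (Fin 2) k) : Matrix (Fin 2) (Fin 2) k) =
          ((ZMod.castHom (dvd_refl p) k (((omegaModP p γ) ^ t : (ZMod p)ˣ) : ZMod p)) •
            ((τ₀ γ : GL (Fin 2) (padicAlgClResidueField p)) :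
              Matrix (Fin 2) (Fin 2) (padicAlgClResidueField p)).map ιk) := by
  intro p _ k _ _ _ _ ιk t ρ₀ τ₀ hodd hτ₀ hirr
  -- the character `χ = ω̄^t` in `kˣ` and the homomorphism `σ₀`
  let χ : absoluteGaloisGroup ℚ →* kˣ :=
    (Units.map (ZMod.castHom (dvd_refl p) k).toMonoidHom).comp ((powMonoidHom t).comp (omegaModP p))
  have hχ : ∀ γ, (χ γ : k) = ZMod.castHom (dvd_refl p) k (((omegaModP p γ) ^ t : (ZMod p)ˣ) : ZMod p) :=
    fun _ => rfl
  let τk : absoluteGaloisGroup ℚ →* GL (Fin 2) k := (Matrix.GeneralLinearGroup.map ιk).comp τ₀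
  let σ₀ : absoluteGaloisGroup ℚ →* GL (Fin 2) k :=
    { toFun := fun γ => Matrix.GeneralLinearGroup.scalar (Fin 2) (χ γ) * τk γ
      map_one' := by rw [map_one, map_one, map_one, one_mul]
      map_mul' := fun a b => by
        have hc : Matrix.GeneralLinearGroup.scalar (Fin 2) (χ b) * τk a =
            τk a * Matrix.GeneralLinearGroup.scalar (Fin 2) (χ b) :=
          Matrix.GeneralLinearGroup.scalar_commute _ _
        rw [map_mul, map_mul, map_mul, mul_assoc,
          ← mul_assoc (Matrix.GeneralLinearGroup.scalar (Fin 2) (χ b)), hc]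
        simp only [mul_assoc] }
  have hσ₀ : ∀ γ, ((σ₀ γ : GL (Fin 2) k) : Matrix (Fin 2) (Fin 2) k) =
      ((ZMod.castHom (dvd_refl p) k (((omegaModP p γ) ^ t : (ZMod p)ˣ) : ZMod p)) •
        ((τ₀ γ : GL (Fin 2) (padicAlgClResidueField p)) :
          Matrix (Fin 2) (Fin 2) (padicAlgClResidueField p)).map ιk) := fun γ => by
    change Matrix.scalar (Fin 2) ((χ γ : kˣ) : k) *
      ((τ₀ γ : GL (Fin 2) (padicAlgClResidueField p)) :
        Matrix (Fin 2) (Fin 2) (padicAlgClResidueField p)).map ιk = _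
    rw [Matrix.scalar_apply, ← Matrix.smul_one_eq_diagonal, smul_mul_assoc, Matrix.one_mul]
    rfl
  -- open kernel, continuity
  have hker : IsOpen (σ₀.ker : Set (absoluteGaloisGroup ℚ)) := by
    refine Subgroup.isOpen_mono (H₁ := τ₀.ker ⊓ (omegaModP p).ker) ?_ ?_
    · intro γ hγ
      rw [Subgroup.mem_inf, MonoidHom.mem_ker, MonoidHom.mem_ker] at hγ
      rw [MonoidHom.mem_ker]
      apply Units.ext
      rw [hσ₀, hγ.1, hγ.2, one_pow, Units.val_one, map_one, one_smul, Units.val_one,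
        Matrix.map_one _ (map_zero ιk) (map_one ιk), Units.val_one]
    · rw [Subgroup.coe_inf]
      exact (FramedGaloisRep.isOpen_ker_of_isResidualRepOf hτ₀).inter isOpen_ker_omegaModP
  let σb : ModPGaloisRep ℚ k 2 :=
    { toMonoidHom := σ₀
      continuous_toFun := Literature.NumberTheory.Automorphic.MonoidHom.continuous_of_isOpen_ker σ₀ hker }
  have hσb : ∀ γ, σb γ = σ₀ γ := fun _ => rfl
  refine ⟨σb, ?_, ?_, fun γ => by rw [hσb, hσ₀]⟩
  · -- oddness
    intro φ c hc
    apply Units.ext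
    rw [Matrix.GeneralLinearGroup.val_det_apply, Units.val_neg, Units.val_one, hσb, hσ₀,
      Matrix.det_smul, Fintype.card_fin]
    have hmap : (((τ₀ c : GL (Fin 2) (padicAlgClResidueField p)) :
        Matrix (Fin 2) (Fin 2) (padicAlgClResidueField p)).map ιk).det = -1 := by
      have h := RingHom.map_det ιk ((τ₀ c : GL (Fin 2) (padicAlgClResidueField p)) :
        Matrix (Fin 2) (Fin 2) (padicAlgClResidueField p))
      rw [det_eq_neg_one_of_isResidualRepOf hodd hτ₀ hc, map_neg, map_one] at h
      exact h.symm
    have hsq : ((omegaModP p c) ^ t) ^ 2 = 1 := by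
      rw [← pow_mul, mul_comm, pow_mul, ← map_pow, hc.sq_eq_one, map_one, one_pow]
    rw [hmap, mul_neg, mul_one, ← map_pow, ← Units.val_pow_eq_pow_val, hsq, Units.val_one, map_one]
  · -- irreducibility
    change (glRepresentation σ₀).IsIrreducible
    have h1 : (glRepresentation ((Matrix.GeneralLinearGroup.map ιk).comp
        ((glAdZeroTwoFrame (padicAlgClResidueField p)).comp τ₀))).IsIrreducible := hirr k ιk
    have hcomm : (Matrix.GeneralLinearGroup.map ιk).comp
        ((glAdZeroTwoFrame (padicAlgClResidueField p)).comp τ₀) = (glAdZeroTwoFrame k).comp τk := by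
      refine MonoidHom.ext fun γ => ?_
      simp only [MonoidHom.comp_apply]
      exact map_glAdZeroTwoFrame ιk (τ₀ γ)
    rw [hcomm] at h1
    have h2 := isIrreducible_of_isIrreducible_adZero _ h1
    refine isIrreducible_of_smul (τ := τk) (σ := σ₀) (fun γ => (((χ γ)⁻¹ : kˣ) : k)) (fun γ => ?_) h2
    rw [hσ₀, ← hχ, smul_smul, Units.inv_mul, one_smul]
    rfl

end Summit.Langlands.Langlands.Cruxes.AdjointLiftingGL3.Birth

end
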